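import Literature.NumberTheory.GaloisRepresentations.UnitIdelesHerbrand
import Mathlib.NumberTheory.NumberField.CMField
import Mathlib.NumberTheory.NumberField.InfinitePlace.Ramification
import HarnessLib

/-!
# The archimedean Herbrand factor `∏_{v ∣ ∞} e_v = 2^{[k : ℚ]}` of a totally complex Galois extension of a totally
# real field — in particular of a CM field over its maximal real subfield (Childress Prop. 5.10; input of
# Chevalley's ambiguous class number formula for `K/K⁺`, Okazaki 2000 Lemma 17)

Topic `NumberTheory/NumberFields`; namespace `Literature.NumberTheory.NumberFields`.  Theorem-only file (no
definition, no named fact, no `sorry`).  The tree's `ArchHerbrand.archFactor k K = ∏_{v ∣ ∞} #G_{w_v}`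
(`UnitIdelesHerbrand.lean`; `#G_{w_v} ∈ {1, 2}` is the decomposition group at a place `w_v ∣ v`, i.e. the
ramification index `e_v` of `v` in `K`) is the factor `∏_{v ∣ ∞} e_v` of Chevalley's formula
`#Cl(L)^G · [L : K] · [E_K : E_K ∩ N Lˣ] = h_K · ∏_𝔭 e_𝔭 · ∏_{v ∣ ∞} e_v` (`AmbiguousClassNumberFormula.lean`).  The tree
evaluates it only when `K/k` is unramified at infinity (`archFactor_eq_one`, `HilbertTheorem92.lean`).  Here: **if every
infinite place of `K` is ramified over `k` — e.g. `k` totally real and `K` totally complex, e.g. a CM field over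
`K⁺` — then `archFactor k K = 2^{#{v ∣ ∞ of k}} = 2^{[k : ℚ]}`**, the value Okazaki's Lemma 17 feeds into Takagi's /
Chevalley's count «`#A_F = (Q̃_F/Q_F)·2^{t−1}·h_{F⁺}`» of ambiguous classes of a CM field.

> Childress, *Class Field Theory* (2009), Ch. 4 §5 Prop. 5.10: the Herbrand quotient of the units of a cyclic
> extension is `2^a/[L:K]` with `2^a = ∏_{v ∣ ∞} #G_{w_v}`, `a` = the number of real places of `K` that become
> complex in `L`.  Okazaki, Acta Arith. 92 (2000), §3 Lemma 17 (proof): «Satz 15 evaluates the order of `A_F`».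

## Main results

* `archFactor_eq_two_pow_card_of_forall_not_isUnramified` — all infinite places ramified ⟹
  `archFactor k K = 2 ^ #(InfinitePlace k)`.
* `archFactor_eq_two_pow_finrank_of_isTotallyComplex` — `k` totally real, `K` totally complex, `K/k` Galois ⟹
  `archFactor k K = 2 ^ [k : ℚ]`.
* **`IsCMField.archFactor_maximalRealSubfield_eq`** — for a CM field `K`: `archFactor K⁺ K = 2 ^ [K⁺ : ℚ]`;
  `IsCMField.archFactor_maximalRealSubfield_eq'` — `= 2 ^ #(InfinitePlace K)` (`#(InfinitePlace K) = [K⁺ : ℚ]`).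

## References

* N. Childress, *Class Field Theory*, Universitext (2009), Ch. 4 §5 Prop. 5.10. [Childress2009]
* R. Okazaki, *Inclusion of CM-fields and divisibility of relative class numbers*, Acta Arith. 92 (2000), §3
  Lemma 17 (proof). [Okazaki2000]
-/

noncomputable section

open NumberField NumberField.InfinitePlace

namespace Literature.NumberTheory.NumberFields

open Literature.NumberTheory.GaloisRepresentations

universe u

variable {k : Type u} [Field k] [NumberField k] {K : Type u} [Field K] [Algebra k K]

/-- **All infinite places ramified ⟹ `∏_{v ∣ ∞} #G_{w_v} = 2^{#(v ∣ ∞)}`** (each decomposition group at infinity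
has order `2`, Mathlib `not_isUnramified_iff_card_stabilizer_eq_two`). [cite: Childress2009, Ch. 4 §5 Prop. 5.10] -/
theorem archFactor_eq_two_pow_card_of_forall_not_isUnramified [IsGalois k K]
    (h : ∀ w : InfinitePlace K, ¬ IsUnramified k w) :
    ArchHerbrand.archFactor k K = 2 ^ Fintype.card (InfinitePlace k) := by
  classical
  unfold ArchHerbrand.archFactor
  rw [← Finset.card_univ, ← Finset.prod_const]
  exact Finset.prod_congr rfl fun v _ =>
    NumberField.InfinitePlace.not_isUnramified_iff_card_stabilizer_eq_two.mp (h _)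

/-- **`k` totally real, `K` totally complex, `K/k` Galois ⟹ `∏_{v ∣ ∞} #G_{w_v} = 2^{[k : ℚ]}`**: a complex place
above a real place is ramified (Mathlib `not_isUnramified_iff`), and a totally real `k` has `[k : ℚ]` infinite
places. [cite: Childress2009, Ch. 4 §5 Prop. 5.10] -/
theorem archFactor_eq_two_pow_finrank_of_isTotallyComplex [IsGalois k K] [IsTotallyReal k]
    [IsTotallyComplex K] :
    ArchHerbrand.archFactor k K = 2 ^ Module.finrank ℚ k := by
  rw [archFactor_eq_two_pow_card_of_forall_not_isUnramified (k := k) (K := K) fun w =>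
      NumberField.InfinitePlace.not_isUnramified_iff.mpr
        ⟨IsTotallyComplex.isComplex w, IsTotallyReal.isReal _⟩,
    card_eq_nrRealPlaces_add_nrComplexPlaces, IsTotallyReal.nrComplexPlaces_eq_zero, add_zero,
    ← IsTotallyReal.finrank]

/-- **For a CM field `K`: `∏_{v ∣ ∞} e_v(K/K⁺) = 2^{[K⁺ : ℚ]}`** — every real place of `K⁺` becomes complex in `K`.
[cite: Okazaki2000, §3 Lemma 17 (proof)] [cite: Childress2009, Ch. 4 §5 Prop. 5.10] -/
theorem IsCMField.archFactor_maximalRealSubfield_eq (K : Type) [Field K] [NumberField K] [IsCMField K] :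
    ArchHerbrand.archFactor (maximalRealSubfield K) K = 2 ^ Module.finrank ℚ (maximalRealSubfield K) :=
  archFactor_eq_two_pow_finrank_of_isTotallyComplex

/-- The same with the exponent as the number of infinite places of `K` (`= [K⁺ : ℚ] = [K : ℚ]/2`, all complex).
[cite: Okazaki2000, §3 Lemma 17 (proof)] -/
theorem IsCMField.archFactor_maximalRealSubfield_eq' (K : Type) [Field K] [NumberField K] [IsCMField K] :
    ArchHerbrand.archFactor (maximalRealSubfield K) K = 2 ^ Fintype.card (InfinitePlace K) := by
  rw [IsCMField.archFactor_maximalRealSubfield_eq, ← IsCMField.card_infinitePlace_eq_card_infinitePlace,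
    card_eq_nrRealPlaces_add_nrComplexPlaces, IsTotallyReal.nrComplexPlaces_eq_zero, add_zero,
    ← IsTotallyReal.finrank]

end Literature.NumberTheory.NumberFields

end
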